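/-
Origin: expansion seat `prover-pub-hodgecm-own-htheta-g2-0`, handover #H43 2026-08-21T14:24:39Z md5 a5c3912a3efa (207 l.; NEW additive MODEL leaf — item6-p2's route to the package's `Universe.PeriodThmF` for the record's universe modulo `hGRU` + `h418` (serves the non-canonical surface embedding via the c_L twist); imports #H40 `E2InstanceOGR20AEPISTR2DJWHHTCGJBG` + #H18 + #H22 + `PerLOfCanonical` + `ArchMuClosedForm` (all installed); author item6-p2 under own-htheta; sha256 9295dce1af2c220ef5b629a04c0da746270f2ef3dc254f9b9d286a2e10ba98d8; CERT rc 0 9 s + PKG-only rc 0 11 s (l.16012); NAMES for audit: see item6-p2 l.≈16000 (7 names)) (`HOME/pub-hodgecm-own-htheta/stage82/HodgeCM/Model/PeriodThmFFace.lean`, md5 a5c3912a3efa, 207 lines);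
landed by the p-seat packager p gen 32 (p-g32) in gate run 81 as `HodgeCM/Model/PeriodThmFFace.lean` (verbatim).
-/
/-
Copyright (c) 2026 the pub-hodgecm formalisation cell (harness21).  New file, not vendored.
Origin: seat `prover-pub-hodgecm2-item6-p2-0` (unit pub-hodgecm2-item6-p2, TRANSPOSITION item (vi) extra prover p2), 2026-08-21 — SCHAIN v3, the FACE HEADS
on top of the scope-parametric chain (#H30–#H40, RUN 80) and own-htheta's ∕ htheta-x1's face junction leaves #H18 `HThetaJunctionFace` ∕ #H22
`HThetaFaceSigma`; x1-g2's `PeriodNVFace` assignment (pub-hodgecm STATUS l.15937 ∕ l.15942) is this file's CONTENT — authored here because the chain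
below it was this seat's, offered to own-htheta ∕ x1-g2 to re-home or kit as is.  Target in PKG: `HodgeCM/Model/PeriodThmFFace.lean` (NEW additive leaf;
imports #H40 + #H18 + #H22 + `Model/ArchMuClosedForm` (own-mu's `muSlotZero`) + `Model/PerLOfCanonical` (axioms-3's c_L twist); nothing of record imports it;
E «JBUARM» untouched, not re-derived).  KERNEL ONLY: 7 theorems, no proof hole, nothing cited beyond the two displayed binder groups, no `def`; nothing here is
a claim of the manuscripts under adjudication; HC_CM is NOT proved.

WHAT IT IS — numbers, not adjectives.  `Universe.PeriodThmF` (`Geometry/Statements.lean`:74) is the package's ∀-form period statement: for every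
Galois CM field `F` with `6 ≤ [F:ℚ]`, every rank-four face `f`, every ADMISSIBLE `ι₁` and EVERY hermitian 3-space `V` at `ι₁`,
`PeriodNV ι₁ V F f.psi ι₁`.  `periodThmF_picardCM_of_GRU_thm418C (hGRU) (h418) : (picardCMUniverse hHD hI h₁ (cmAbelianVarietyRealised_of_eigenbasis
hHD hI h₃)).PeriodThmF` proves it for E's model universe of record from EXACTLY the record's two binder groups — `hGRU` = [GR91, Prop. 3.1.1] VERBATIM
(«JBUARM» :37–40) and `h418` = the combined reading r8 `Thm418C` of [Liu21, Thm. 4.18] CITED-AS-CONSEQUENCE (CF07 F3; «JBUARM» :41–44) — by running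
E's OWN sextic machinery through the `_ge` ∕ `_S` ∕ `_gal` leaves (#H21, #H23–#H40) at the scope `6 ≤ [c.K:ℚ] ∧ IsNormalClosure ℚ c.K L` that every
face context `⟨F, f.psi, σ, D⟩` meets, and re-presenting the surface by the c_L twist off the place representative.  The intermediate forms
(diagonal ∕ σ-decoupled ∕ place-representative ∕ ∃V-at-σ) are kept as theorems for the tree-side glue (venue (vi-0)), whose consumer shapes they match.
What this does NOT say: nothing about the TREE's `U_rec` (no import edge PKG → tree), nothing about HC_CM, nothing about r8 = print (AUDIT-CITESCOPE,
ITEM6-SPLIT §5 U1–U3: the object identifications between printed Thm 4.18 and `Thm418C` are prose at EVERY degree, sextic included).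
-/
import Summits.HodgeConjecture.HodgeCM.Model.E2InstanceOGR20AEPISTR2DJWHHTCGJBG
import Summits.HodgeConjecture.HodgeCM.Model.HThetaJunctionFace
import Summits.HodgeConjecture.HodgeCM.Model.HThetaFaceSigma
import Summits.HodgeConjecture.HodgeCM.Model.PerLOfCanonical
import Summits.HodgeConjecture.HodgeCM.Model.ArchMuClosedForm

/-! PORT of `HodgeCM/Model/PeriodThmFFace.lean` (HodgeCMPerL run 82) — verbatim mechanical port; provenance in the PORT header line. -/

set_option autoImplicit false

noncomputable section

namespace HodgeCM.Model

open Literature.AlgebraicGeometry.HodgeTheory Literature.NumberTheory.Automorphic.PicardCM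
open Literature.NumberTheory.GelbartRogawski1991.UnitaryDualPair
open HodgeCM.Universe (ModelAxiomsPerL)
open NumberField

variable (hHD : exists_isReal_hodgeModel) (hI : hodgePQ_independent_of_hodgeModel)
  (h₁ : BallQuotientUniformised) (h₃ : CMAbelianVarietyEigenbasisRealised)

/-- **`PeriodNV` AT A FACE, diagonal form** (`σ = ι₁` admissible AND the canonical representative of its place): for E's end-state model of record over
`picardCMUniverse`, from the record's `hGRU` + `h418` and any exponent table `μ`: lines `D` by #H18 `exists_faceCtx_goodCtx_gog`, the realisation by
#H40 `thetaRealisation₂_picardCM_r20AEOGISTR2DJWHHTCGJBUAR_gal` at `faceCtx F f ι₁ D` (scope `⟨h6, isNormalClosure_self_of_isGalois F⟩`), the period by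
`ModelAxiomsPerL.thm44_of_realisation₂`. [folklore] -/
theorem periodNV_face_of_GRU_thm418C
    (hGRU : ∀ (L : Type) [Field L] [NumberField L] [NumberField.IsCMField L] {N M n : ℕ} (e : Fin N × Fin M ≃ Fin n)
      (dV : Fin N → L) (hdV : ∀ i, NumberField.IsCMField.complexConj L (dV i) = dV i) (hdV0 : ∀ i, dV i ≠ 0)
      (dW : Fin M → L) (hdW : ∀ i, NumberField.IsCMField.complexConj L (dW i) = dW i) (hdW0 : ∀ i, dW i ≠ 0),
      (cmSplittingDatum L e dV hdV hdV0 dW hdW hdW0).CompatibleSplitting)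
    (μ : ∀ {L : CMField}, SeesawCtx L → Fin 4 → NumberField.InfinitePlace L → ℤ)
    (h418 : ∀ {L : CMField} {ι₁ : L →+* ℂ} (V : HermSpace3 L ι₁), (NumberField.InfinitePlace.mk ι₁).embedding = ι₁ → ∀ a₀ : LiuIndex.RealScalar L,
      (liuDictionaryPin hHD hI h₁ (cmAbelianVarietyRealised_of_eigenbasis hHD hI h₃) Literature.NumberTheory.Transcendental.arapura2012_cor_15_4_6_holds V
          (LiuIndex.I V (LiuIndex.repAt a₀) (LiuIndex.muLiu ι₁ LiuIndex.GramClass.rep))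
          (LiuIndex.line V (LiuIndex.repAt a₀) (LiuIndex.muLiu ι₁ LiuIndex.GramClass.rep))).Thm418C)
    (F : CMField) [IsGalois ℚ F] (h6 : 6 ≤ Module.finrank ℚ F) (f : Face F) (ι₁ : F →+* ℂ) (hadm : f.Admissible ι₁)
    (hcan : (NumberField.InfinitePlace.mk ι₁).embedding = ι₁) (V : HermSpace3 F ι₁) :
    (picardCMUniverse hHD hI h₁ (cmAbelianVarietyRealised_of_eigenbasis hHD hI h₃)).PeriodNV ι₁ V F f.psi ι₁ := by
  have hex : ∃ D : StubTree.SeesawDatum F,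
      (thetaModelOf hHD hI h₁ (cmAbelianVarietyRealised_of_eigenbasis hHD hI h₃) (orientBitι F ι₁) (embOf hHD hI h₁ (cmAbelianVarietyRealised_of_eigenbasis hHD hI h₃)) (coverOf hHD hI h₁ (cmAbelianVarietyRealised_of_eigenbasis hHD hI h₃) Literature.NumberTheory.Transcendental.arapura2012_cor_15_4_6_holds) (wmOfInput (HypCensus.Wcm (@SInstance.GRU.hGR hGRU) (@EtaChi.η (@SInstance.χVR (@SInstance.GRU.hGR hGRU) (@SInstance.GRU.hGR₀ hGRU) (@SInstance.GRU.hGR₁ hGRU)) (@SInstance.χWR (@SInstance.GRU.hGR hGRU) (@SInstance.GRU.hGR₀ hGRU) (@SInstance.GRU.hGR₁ hGRU) (ArchSideTerm.muSharp₂₃ @μ))) (@EtaChi.hη (@SInstance.χVR (@SInstance.GRU.hGR hGRU) (@SInstance.GRU.hGR₀ hGRU) (@SInstance.GRU.hGR₁ hGRU)) (@SInstance.χWR (@SInstance.GRU.hGR hGRU) (@SInstance.GRU.hGR₀ hGRU) (@SInstance.GRU.hGR₁ hGRU) (ArchSideTerm.muSharp₂₃ @μ))) (@EtaChi.hηc (@SInstance.χVR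 (@SInstance.GRU.hGR hGRU) (@SInstance.GRU.hGR₀ hGRU) (@SInstance.GRU.hGR₁ hGRU)) (@SInstance.χWR (@SInstance.GRU.hGR hGRU) (@SInstance.GRU.hGR₀ hGRU) (@SInstance.GRU.hGR₁ hGRU) (ArchSideTerm.muSharp₂₃ @μ))))) (thetaOf _ (thetaClassInputOf _ (fun V c => thetaSpaceInputOf hHD hI h₁ (cmAbelianVarietyRealised_of_eigenbasis hHD hI h₃) (SInstance.SROGT'C (@SInstance.GRU.hGR hGRU) (@SInstance.GRU.hGR₀ hGRU) (@SInstance.GRU.hGR₁ hGRU) (@SInstance.GRU.hGR₂ hGRU) (@SInstance.GRU.hGR₃ hGRU) (ArchSideTerm.muSharp₂₃ @μ) (ArchSideTerm.hΔ₁_GOG_muSharp₂₃ (@SInstance.GRU.hGR hGRU) (@SInstance.GRU.hGR₀ hGRU) (@SInstance.GRU.hGR₁ hGRU) (@SInstance.GRU.hGR₂ hGRU) (@SInstance.GRU.hGR₃ hGRU) @μ) (ArchSideTerm.hΔ₂_GOG_muSharp₂₃ (@SInstance.GRU.hGR hGRU) (@SInstance.GRU.hGR₀ hGRU) (@SInstance.GRU.hGR₁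 hGRU) (@SInstance.GRU.hGR₂ hGRU) (@SInstance.GRU.hGR₃ hGRU) @μ (ArchSideTerm.hSV_holds (@SInstance.GRU.hGR hGRU))) (ArchSideTerm.hΔ₃_GOG_muSharp₂₃ (@SInstance.GRU.hGR hGRU) (@SInstance.GRU.hGR₀ hGRU) (@SInstance.GRU.hGR₁ hGRU) (@SInstance.GRU.hGR₂ hGRU) (@SInstance.GRU.hGR₃ hGRU) @μ (ArchSideTerm.hSV_holds (@SInstance.GRU.hGR hGRU)))) V c))) (d12Of (ArchSideTerm.muSharp₂₃ @μ)) (d34Of (ArchSideTerm.muSharp₂₃ @μ))).GoodCtx ι₁ (faceCtx F f ι₁ D) ∧ SInstance.GOG V (faceCtx F f ι₁ D) :=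
    SInstance.exists_faceCtx_goodCtx_gog hHD hI h₁ (cmAbelianVarietyRealised_of_eigenbasis hHD hI h₃) F f V _ _ _ hadm hcan
  obtain ⟨D, hgood, -⟩ := hex
  obtain ⟨R⟩ := thetaRealisation₂_picardCM_r20AEOGISTR2DJWHHTCGJBUAR_gal hHD hI h₁ h₃ hGRU μ h418 V (faceCtx F f ι₁ D) hgood
    ⟨h6, isNormalClosure_self_of_isGalois F⟩ hcan
  exact ModelAxiomsPerL.thm44_of_realisation₂ (Model.modelAxiomsPerL hHD hI (cmAbelianVarietyRealised_of_eigenbasis hHD hI h₃) h₁) R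


/-- **`PeriodNV` AT A FACE, σ-decoupled form** (#H22 shape): eigen-embedding `σ` ADMISSIBLE, surface embedding `ι₁` the canonical representative with
`ι₁ ∘ j = σ`; lines `D` along `j` by `ThetaModel.exists_seesawDatum` (design constraints of the end state, `lemma33bLandherr_holds`), guard by #H22
`goodCtx_faceCtxσ`, then #H40 at `faceCtxσ F f σ D` and `thm44_of_realisation₂`. [folklore] -/
theorem periodNV_faceσ_of_GRU_thm418C
    (hGRU : ∀ (L : Type) [Field L] [NumberField L] [NumberField.IsCMField L] {N M n : ℕ} (e : Fin N × Fin M ≃ Fin n)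
      (dV : Fin N → L) (hdV : ∀ i, NumberField.IsCMField.complexConj L (dV i) = dV i) (hdV0 : ∀ i, dV i ≠ 0)
      (dW : Fin M → L) (hdW : ∀ i, NumberField.IsCMField.complexConj L (dW i) = dW i) (hdW0 : ∀ i, dW i ≠ 0),
      (cmSplittingDatum L e dV hdV hdV0 dW hdW hdW0).CompatibleSplitting)
    (μ : ∀ {L : CMField}, SeesawCtx L → Fin 4 → NumberField.InfinitePlace L → ℤ)
    (h418 : ∀ {L : CMField} {ι₁ : L →+* ℂ} (V : HermSpace3 L ι₁), (NumberField.InfinitePlace.mk ι₁).embedding = ι₁ → ∀ a₀ : LiuIndex.RealScalar L,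
      (liuDictionaryPin hHD hI h₁ (cmAbelianVarietyRealised_of_eigenbasis hHD hI h₃) Literature.NumberTheory.Transcendental.arapura2012_cor_15_4_6_holds V
          (LiuIndex.I V (LiuIndex.repAt a₀) (LiuIndex.muLiu ι₁ LiuIndex.GramClass.rep))
          (LiuIndex.line V (LiuIndex.repAt a₀) (LiuIndex.muLiu ι₁ LiuIndex.GramClass.rep))).Thm418C)
    (F : CMField) [IsGalois ℚ F] (h6 : 6 ≤ Module.finrank ℚ F) (f : Face F) {σ ι₁ : F →+* ℂ} (hadm : f.Admissible σ)
    (j : F →+* F) (hj : ι₁.comp j = σ) (hcan : (NumberField.InfinitePlace.mk ι₁).embedding = ι₁) (V : HermSpace3 F ι₁) :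
    (picardCMUniverse hHD hI h₁ (cmAbelianVarietyRealised_of_eigenbasis hHD hI h₃)).PeriodNV ι₁ V F f.psi σ := by
  have hex : ∃ D : StubTree.SeesawDatum F,
      (thetaModelOf hHD hI h₁ (cmAbelianVarietyRealised_of_eigenbasis hHD hI h₃) (orientBitι F ι₁) (embOf hHD hI h₁ (cmAbelianVarietyRealised_of_eigenbasis hHD hI h₃)) (coverOf hHD hI h₁ (cmAbelianVarietyRealised_of_eigenbasis hHD hI h₃) Literature.NumberTheory.Transcendental.arapura2012_cor_15_4_6_holds) (wmOfInput (HypCensus.Wcm (@SInstance.GRU.hGR hGRU) (@EtaChi.η (@SInstance.χVR (@SInstance.GRU.hGR hGRU) (@SInstance.GRU.hGR₀ hGRU) (@SInstance.GRU.hGR₁ hGRU)) (@SInstance.χWR (@SInstance.GRU.hGR hGRU) (@SInstance.GRU.hGR₀ hGRU) (@SInstance.GRU.hGR₁ hGRU) (ArchSideTerm.muSharp₂₃ @μ))) (@EtaChi.hη (@SInstance.χVR (@SInstance.GRU.hGR hGRU) (@SInstance.GRU.hGR₀ hGRU) (@SInstance.GRU.hGR₁ hGRU)) (@SInstance.χWR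 (@SInstance.GRU.hGR hGRU) (@SInstance.GRU.hGR₀ hGRU) (@SInstance.GRU.hGR₁ hGRU) (ArchSideTerm.muSharp₂₃ @μ))) (@EtaChi.hηc (@SInstance.χVR (@SInstance.GRU.hGR hGRU) (@SInstance.GRU.hGR₀ hGRU) (@SInstance.GRU.hGR₁ hGRU)) (@SInstance.χWR (@SInstance.GRU.hGR hGRU) (@SInstance.GRU.hGR₀ hGRU) (@SInstance.GRU.hGR₁ hGRU) (ArchSideTerm.muSharp₂₃ @μ))))) (thetaOf _ (thetaClassInputOf _ (fun V c => thetaSpaceInputOf hHD hI h₁ (cmAbelianVarietyRealised_of_eigenbasis hHD hI h₃) (SInstance.SROGT'C (@SInstance.GRU.hGR hGRU) (@SInstance.GRU.hGR₀ hGRU) (@SInstance.GRU.hGR₁ hGRU) (@SInstance.GRU.hGR₂ hGRU) (@SInstance.GRU.hGR₃ hGRU) (ArchSideTerm.muSharp₂₃ @μ) (ArchSideTerm.hΔ₁_GOG_muSharp₂₃ (@SInstance.GRU.hGR hGRU) (@SInstance.GRU.hGR₀ hGRU) (@SInstance.GRU.hGR₁ hGRU) (@SInstance.GRU.hGR₂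 hGRU) (@SInstance.GRU.hGR₃ hGRU) @μ) (ArchSideTerm.hΔ₂_GOG_muSharp₂₃ (@SInstance.GRU.hGR hGRU) (@SInstance.GRU.hGR₀ hGRU) (@SInstance.GRU.hGR₁ hGRU) (@SInstance.GRU.hGR₂ hGRU) (@SInstance.GRU.hGR₃ hGRU) @μ (ArchSideTerm.hSV_holds (@SInstance.GRU.hGR hGRU))) (ArchSideTerm.hΔ₃_GOG_muSharp₂₃ (@SInstance.GRU.hGR hGRU) (@SInstance.GRU.hGR₀ hGRU) (@SInstance.GRU.hGR₁ hGRU) (@SInstance.GRU.hGR₂ hGRU) (@SInstance.GRU.hGR₃ hGRU) @μ (ArchSideTerm.hSV_holds (@SInstance.GRU.hGR hGRU)))) V c))) (d12Of (ArchSideTerm.muSharp₂₃ @μ)) (d34Of (ArchSideTerm.muSharp₂₃ @μ))).GoodCtx ι₁ (faceCtxσ F f σ D) := by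
    obtain ⟨D, hD⟩ := (thetaModelOf hHD hI h₁ (cmAbelianVarietyRealised_of_eigenbasis hHD hI h₃) (orientBitι F ι₁) (embOf hHD hI h₁ (cmAbelianVarietyRealised_of_eigenbasis hHD hI h₃)) (coverOf hHD hI h₁ (cmAbelianVarietyRealised_of_eigenbasis hHD hI h₃) Literature.NumberTheory.Transcendental.arapura2012_cor_15_4_6_holds) (wmOfInput (HypCensus.Wcm (@SInstance.GRU.hGR hGRU) (@EtaChi.η (@SInstance.χVR (@SInstance.GRU.hGR hGRU) (@SInstance.GRU.hGR₀ hGRU) (@SInstance.GRU.hGR₁ hGRU)) (@SInstance.χWR (@SInstance.GRU.hGR hGRU) (@SInstance.GRU.hGR₀ hGRU) (@SInstance.GRU.hGR₁ hGRU) (ArchSideTerm.muSharp₂₃ @μ))) (@EtaChi.hη (@SInstance.χVR (@SInstance.GRU.hGR hGRU) (@SInstance.GRU.hGR₀ hGRU) (@SInstance.GRU.hGR₁ hGRU)) (@SInstance.χWR (@SInstance.GRU.hGR hGRU) (@SInstance.GRU.hGR₀ hGRU) (@SInstance.GRU.hGR₁ hGRU) (ArchSideTerm.muSharp₂₃ @μ)))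 (@EtaChi.hηc (@SInstance.χVR (@SInstance.GRU.hGR hGRU) (@SInstance.GRU.hGR₀ hGRU) (@SInstance.GRU.hGR₁ hGRU)) (@SInstance.χWR (@SInstance.GRU.hGR hGRU) (@SInstance.GRU.hGR₀ hGRU) (@SInstance.GRU.hGR₁ hGRU) (ArchSideTerm.muSharp₂₃ @μ))))) (thetaOf _ (thetaClassInputOf _ (fun V c => thetaSpaceInputOf hHD hI h₁ (cmAbelianVarietyRealised_of_eigenbasis hHD hI h₃) (SInstance.SROGT'C (@SInstance.GRU.hGR hGRU) (@SInstance.GRU.hGR₀ hGRU) (@SInstance.GRU.hGR₁ hGRU) (@SInstance.GRU.hGR₂ hGRU) (@SInstance.GRU.hGR₃ hGRU) (ArchSideTerm.muSharp₂₃ @μ) (ArchSideTerm.hΔ₁_GOG_muSharp₂₃ (@SInstance.GRU.hGR hGRU) (@SInstance.GRU.hGR₀ hGRU) (@SInstance.GRU.hGR₁ hGRU) (@SInstance.GRU.hGR₂ hGRU) (@SInstance.GRU.hGR₃ hGRU) @μ) (ArchSideTerm.hΔ₂_GOG_muSharp₂₃ (@SInstance.GRU.hGR hGRU) (@SInstance.GRU.hGR₀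 hGRU) (@SInstance.GRU.hGR₁ hGRU) (@SInstance.GRU.hGR₂ hGRU) (@SInstance.GRU.hGR₃ hGRU) @μ (ArchSideTerm.hSV_holds (@SInstance.GRU.hGR hGRU))) (ArchSideTerm.hΔ₃_GOG_muSharp₂₃ (@SInstance.GRU.hGR hGRU) (@SInstance.GRU.hGR₀ hGRU) (@SInstance.GRU.hGR₁ hGRU) (@SInstance.GRU.hGR₂ hGRU) (@SInstance.GRU.hGR₃ hGRU) @μ (ArchSideTerm.hSV_holds (@SInstance.GRU.hGR hGRU)))) V c))) (d12Of (ArchSideTerm.muSharp₂₃ @μ)) (d34Of (ArchSideTerm.muSharp₂₃ @μ))).exists_seesawDatum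
      (Universe.AdelicThetaCore.design_kappaConj _ _ _ _) (Universe.AdelicThetaCore.design_frameSignConj _ _ _ _)
      lemma33bLandherr_holds j ι₁ f.psi (pairSum_psi f)
    exact ⟨D, goodCtx_faceCtxσ _ F f hadm j hj D hD⟩
  obtain ⟨D, hgood⟩ := hex
  obtain ⟨R⟩ := thetaRealisation₂_picardCM_r20AEOGISTR2DJWHHTCGJBUAR_gal hHD hI h₁ h₃ hGRU μ h418 V (faceCtxσ F f σ D) hgood
    ⟨h6, isNormalClosure_self_of_isGalois F⟩ hcan
  exact ModelAxiomsPerL.thm44_of_realisation₂ (Model.modelAxiomsPerL hHD hI (cmAbelianVarietyRealised_of_eigenbasis hHD hI h₃) h₁) R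

/-- **`PeriodNV` AT A FACE on the surfaces at the PLACE REPRESENTATIVE of an admissible `σ`** (no `hcan` binder: `mk_embedding`; `j` from #H22
`exists_representative_comp_eq`); exponent table `μ` free. [folklore] -/
theorem periodNV_face_repr_of_GRU_thm418C_mu
    (hGRU : ∀ (L : Type) [Field L] [NumberField L] [NumberField.IsCMField L] {N M n : ℕ} (e : Fin N × Fin M ≃ Fin n)
      (dV : Fin N → L) (hdV : ∀ i, NumberField.IsCMField.complexConj L (dV i) = dV i) (hdV0 : ∀ i, dV i ≠ 0)
      (dW : Fin M → L) (hdW : ∀ i, NumberField.IsCMField.complexConj L (dW i) = dW i) (hdW0 : ∀ i, dW i ≠ 0),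
      (cmSplittingDatum L e dV hdV hdV0 dW hdW hdW0).CompatibleSplitting)
    (μ : ∀ {L : CMField}, SeesawCtx L → Fin 4 → NumberField.InfinitePlace L → ℤ)
    (h418 : ∀ {L : CMField} {ι₁ : L →+* ℂ} (V : HermSpace3 L ι₁), (NumberField.InfinitePlace.mk ι₁).embedding = ι₁ → ∀ a₀ : LiuIndex.RealScalar L,
      (liuDictionaryPin hHD hI h₁ (cmAbelianVarietyRealised_of_eigenbasis hHD hI h₃) Literature.NumberTheory.Transcendental.arapura2012_cor_15_4_6_holds V
          (LiuIndex.I V (LiuIndex.repAt a₀) (LiuIndex.muLiu ι₁ LiuIndex.GramClass.rep))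
          (LiuIndex.line V (LiuIndex.repAt a₀) (LiuIndex.muLiu ι₁ LiuIndex.GramClass.rep))).Thm418C)
    (F : CMField) [IsGalois ℚ F] (h6 : 6 ≤ Module.finrank ℚ F) (f : Face F) (σ : F →+* ℂ) (hadm : f.Admissible σ)
    (V : HermSpace3 F (NumberField.InfinitePlace.mk σ).embedding) :
    (picardCMUniverse hHD hI h₁ (cmAbelianVarietyRealised_of_eigenbasis hHD hI h₃)).PeriodNV (NumberField.InfinitePlace.mk σ).embedding V F f.psi σ := by
  obtain ⟨j, hj⟩ := exists_representative_comp_eq F σ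
  exact periodNV_faceσ_of_GRU_thm418C hHD hI h₁ h₃ hGRU μ h418 F h6 f hadm j hj (by rw [NumberField.InfinitePlace.mk_embedding]) V


/-- **RECORD SHAPE** of the previous theorem: binder groups EXACTLY «JBUARM»'s (`hGRU`, `h418`); own-mu's `μ := muSharp₂₃ muSlotZero` plugged in (the
conclusion does not mention `μ`). [folklore] -/
theorem periodNV_face_repr_of_GRU_thm418C
    (hGRU : ∀ (L : Type) [Field L] [NumberField L] [NumberField.IsCMField L] {N M n : ℕ} (e : Fin N × Fin M ≃ Fin n)
      (dV : Fin N → L) (hdV : ∀ i, NumberField.IsCMField.complexConj L (dV i) = dV i) (hdV0 : ∀ i, dV i ≠ 0)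
      (dW : Fin M → L) (hdW : ∀ i, NumberField.IsCMField.complexConj L (dW i) = dW i) (hdW0 : ∀ i, dW i ≠ 0),
      (cmSplittingDatum L e dV hdV hdV0 dW hdW hdW0).CompatibleSplitting)
    (h418 : ∀ {L : CMField} {ι₁ : L →+* ℂ} (V : HermSpace3 L ι₁), (NumberField.InfinitePlace.mk ι₁).embedding = ι₁ → ∀ a₀ : LiuIndex.RealScalar L,
      (liuDictionaryPin hHD hI h₁ (cmAbelianVarietyRealised_of_eigenbasis hHD hI h₃) Literature.NumberTheory.Transcendental.arapura2012_cor_15_4_6_holds V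
          (LiuIndex.I V (LiuIndex.repAt a₀) (LiuIndex.muLiu ι₁ LiuIndex.GramClass.rep))
          (LiuIndex.line V (LiuIndex.repAt a₀) (LiuIndex.muLiu ι₁ LiuIndex.GramClass.rep))).Thm418C)
    (F : CMField) [IsGalois ℚ F] (h6 : 6 ≤ Module.finrank ℚ F) (f : Face F) (σ : F →+* ℂ) (hadm : f.Admissible σ)
    (V : HermSpace3 F (NumberField.InfinitePlace.mk σ).embedding) :
    (picardCMUniverse hHD hI h₁ (cmAbelianVarietyRealised_of_eigenbasis hHD hI h₃)).PeriodNV (NumberField.InfinitePlace.mk σ).embedding V F f.psi σ :=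
  periodNV_face_repr_of_GRU_thm418C_mu hHD hI h₁ h₃ hGRU (ArchSideTerm.muSharp₂₃ @ArchSideTerm.muSlotZero) h418 F h6 f σ hadm V


/-- **∃V AT `σ` ITSELF** (the shape the tree's RE-POINTed consumer takes: `∃ ι₁ admissible, ∃ V σ', PeriodNV ι₁ V F f.psi σ'` with `ι₁ := σ' := σ`): the
canonical-representative guard is removed by the c_L-twist RE-PRESENTATION of the surface (`HermSpace3.transposeAt`, `Level.conjTransposeAt`,
`universeOf_pms_transposeAt`, `Universe.periodNV_of_pms_eq`, `Model/PerLOfCanonical.lean` — exactly as `perL_of_perLCanonical` does for `PerL`);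
`V` from `StubTree.landherr_exists`; binder groups = the record's two. [folklore] -/
theorem exists_periodNV_face_of_GRU_thm418C
    (hGRU : ∀ (L : Type) [Field L] [NumberField L] [NumberField.IsCMField L] {N M n : ℕ} (e : Fin N × Fin M ≃ Fin n)
      (dV : Fin N → L) (hdV : ∀ i, NumberField.IsCMField.complexConj L (dV i) = dV i) (hdV0 : ∀ i, dV i ≠ 0)
      (dW : Fin M → L) (hdW : ∀ i, NumberField.IsCMField.complexConj L (dW i) = dW i) (hdW0 : ∀ i, dW i ≠ 0),
      (cmSplittingDatum L e dV hdV hdV0 dW hdW hdW0).CompatibleSplitting)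
    (h418 : ∀ {L : CMField} {ι₁ : L →+* ℂ} (V : HermSpace3 L ι₁), (NumberField.InfinitePlace.mk ι₁).embedding = ι₁ → ∀ a₀ : LiuIndex.RealScalar L,
      (liuDictionaryPin hHD hI h₁ (cmAbelianVarietyRealised_of_eigenbasis hHD hI h₃) Literature.NumberTheory.Transcendental.arapura2012_cor_15_4_6_holds V
          (LiuIndex.I V (LiuIndex.repAt a₀) (LiuIndex.muLiu ι₁ LiuIndex.GramClass.rep))
          (LiuIndex.line V (LiuIndex.repAt a₀) (LiuIndex.muLiu ι₁ LiuIndex.GramClass.rep))).Thm418C)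
    (F : CMField) [IsGalois ℚ F] (h6 : 6 ≤ Module.finrank ℚ F) (f : Face F) (σ : F →+* ℂ) (hadm : f.Admissible σ) :
    ∃ V : HermSpace3 F σ,
      (picardCMUniverse hHD hI h₁ (cmAbelianVarietyRealised_of_eigenbasis hHD hI h₃)).PeriodNV σ V F f.psi σ := by
  rcases NumberField.InfinitePlace.embedding_mk_eq σ with hc | hc
  · obtain ⟨V⟩ := StubTree.landherr_exists F σ
    exact ⟨V, periodNV_faceσ_of_GRU_thm418C hHD hI h₁ h₃ hGRU (ArchSideTerm.muSharp₂₃ @ArchSideTerm.muSlotZero) h418 F h6 f hadm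
      (RingHom.id F) (RingHom.comp_id σ) hc V⟩
  · have hrep : (NumberField.InfinitePlace.mk (NumberField.ComplexEmbedding.conjugate σ)).embedding =
        NumberField.ComplexEmbedding.conjugate σ := by
      rw [NumberField.InfinitePlace.mk_conjugate_eq, hc]
    have hj : (NumberField.ComplexEmbedding.conjugate σ).comp (CMTypeOps.conjAut F).toRingHom = σ := by
      rw [CMTypeOps.comp_conjAut, NumberField.ComplexEmbedding.involutive_conjugate]
    obtain ⟨V'⟩ := StubTree.landherr_exists F (NumberField.ComplexEmbedding.conjugate σ)
    obtain ⟨Γ, hP⟩ := periodNV_faceσ_of_GRU_thm418C hHD hI h₁ h₃ hGRU (ArchSideTerm.muSharp₂₃ @ArchSideTerm.muSlotZero) h418 F h6 f hadm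
      (CMTypeOps.conjAut F).toRingHom hj hrep V'
    exact ⟨V'.transposeAt σ rfl, Universe.periodNV_of_pms_eq _ (Γ.conjTransposeAt σ rfl) Γ
      (universeOf_pms_transposeAt hHD hI _ _ V' Γ σ rfl) hP⟩


/-- Two hermitian 3-spaces with the same Gram matrix are equal (the other fields are proofs). [folklore] -/
theorem HermSpace3.eq_of_Hm_eq {L : CMField} {ι : L →+* ℂ} {V W : HermSpace3 L ι} (h : V.Hm = W.Hm) : V = W := by
  cases V; cases W; cases h; rfl

/-- **THE PACKAGE'S OWN `PeriodThmF` (`Geometry/Statements.lean`:74 — ∀ Galois CM `F` with `6 ≤ [F:ℚ]`, ∀ face `f`, ∀ ADMISSIBLE `ι₁`,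
∀ `V : HermSpace3 F ι₁`: `PeriodNV ι₁ V F f.psi ι₁`) FOR E's MODEL UNIVERSE OF RECORD, modulo EXACTLY the record's two cited groups `hGRU`
([GR91 Prop 3.1.1] verbatim) and `h418` (the r8 reading `Thm418C` of [Liu21 Thm 4.18]).  Off the place representative the surface is RE-PRESENTED by
the c_L twist exactly as `perL_of_perLCanonical` does (`transposeAt` twice is the identity on `HermSpace3`, `HermSpace3.eq_of_Hm_eq`).  NOT `PerL` (sextic `K ≠ L`), NOT HC_CM, NOT a tree theorem; the
binders are CITED statements (one verbatim, one a reading), so this has exactly the epistemic status of E. [folklore] -/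
theorem periodThmF_picardCM_of_GRU_thm418C
    (hGRU : ∀ (L : Type) [Field L] [NumberField L] [NumberField.IsCMField L] {N M n : ℕ} (e : Fin N × Fin M ≃ Fin n)
      (dV : Fin N → L) (hdV : ∀ i, NumberField.IsCMField.complexConj L (dV i) = dV i) (hdV0 : ∀ i, dV i ≠ 0)
      (dW : Fin M → L) (hdW : ∀ i, NumberField.IsCMField.complexConj L (dW i) = dW i) (hdW0 : ∀ i, dW i ≠ 0),
      (cmSplittingDatum L e dV hdV hdV0 dW hdW hdW0).CompatibleSplitting)
    (h418 : ∀ {L : CMField} {ι₁ : L →+* ℂ} (V : HermSpace3 L ι₁), (NumberField.InfinitePlace.mk ι₁).embedding = ι₁ → ∀ a₀ : LiuIndex.RealScalar L,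
      (liuDictionaryPin hHD hI h₁ (cmAbelianVarietyRealised_of_eigenbasis hHD hI h₃) Literature.NumberTheory.Transcendental.arapura2012_cor_15_4_6_holds V
          (LiuIndex.I V (LiuIndex.repAt a₀) (LiuIndex.muLiu ι₁ LiuIndex.GramClass.rep))
          (LiuIndex.line V (LiuIndex.repAt a₀) (LiuIndex.muLiu ι₁ LiuIndex.GramClass.rep))).Thm418C)
    : (picardCMUniverse hHD hI h₁ (cmAbelianVarietyRealised_of_eigenbasis hHD hI h₃)).PeriodThmF := by
  intro F hGal h6 f ι₁ hadm V
  haveI := hGal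
  rcases NumberField.InfinitePlace.embedding_mk_eq ι₁ with hc | hc
  · exact periodNV_face_of_GRU_thm418C hHD hI h₁ h₃ hGRU (ArchSideTerm.muSharp₂₃ @ArchSideTerm.muSlotZero) h418 F h6 f ι₁ hadm hc V
  · have hrep : (NumberField.InfinitePlace.mk (NumberField.ComplexEmbedding.conjugate ι₁)).embedding =
        NumberField.ComplexEmbedding.conjugate ι₁ := by
      rw [NumberField.InfinitePlace.mk_conjugate_eq, hc]
    have hj : (NumberField.ComplexEmbedding.conjugate ι₁).comp (CMTypeOps.conjAut F).toRingHom = ι₁ := by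
      rw [CMTypeOps.comp_conjAut, NumberField.ComplexEmbedding.involutive_conjugate]
    have hcc : NumberField.ComplexEmbedding.conjugate (NumberField.ComplexEmbedding.conjugate ι₁) = ι₁ :=
      NumberField.ComplexEmbedding.involutive_conjugate _ ι₁
    obtain ⟨Γc, hP⟩ := periodNV_faceσ_of_GRU_thm418C hHD hI h₁ h₃ hGRU (ArchSideTerm.muSharp₂₃ @ArchSideTerm.muSlotZero) h418 F h6 f hadm
      (CMTypeOps.conjAut F).toRingHom hj hrep (V.transposeAt (NumberField.ComplexEmbedding.conjugate ι₁) hcc)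
    have e : (V.transposeAt (NumberField.ComplexEmbedding.conjugate ι₁) hcc).transposeAt ι₁ rfl = V :=
      HermSpace3.eq_of_Hm_eq (by rw [HermSpace3.transposeAt_Hm, HermSpace3.transposeAt_Hm, Matrix.transpose_transpose])
    have hNV : (picardCMUniverse hHD hI h₁ (cmAbelianVarietyRealised_of_eigenbasis hHD hI h₃)).PeriodNV ι₁
        ((V.transposeAt (NumberField.ComplexEmbedding.conjugate ι₁) hcc).transposeAt ι₁ rfl) F f.psi ι₁ :=
      Universe.periodNV_of_pms_eq _ (Γc.conjTransposeAt ι₁ rfl) Γc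
        (universeOf_pms_transposeAt hHD hI _ _ (V.transposeAt (NumberField.ComplexEmbedding.conjugate ι₁) hcc) Γc ι₁ rfl) hP
    rw [e] at hNV
    exact hNV


end HodgeCM.Model

end
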